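/-
Copyright: the b2b-balaban T⁴-continuum CRUX team, row NE7b OWNER lineage `t4-ne7b-p1` (gen 108). Project licence.
-/
import Summits.QuantumFields.BalabanUV.T4Continuum.Spine.NE7b.ConvexWindowTiltCentred

/-!
# THE VIRIAL-TWIN SOCKET OF THE WINDOWED CONVEXITY ROAD: `V = ⟪x,Ax⟫ + P`, `P` HESSIAN-SMALL ON THE WINDOW, CRITICAL CENTRE
# `DP(0) = 0` ⟹ `∫_K e^{−V} ≤ exp((Σ_k q_k + n·q_max)∕(2σ − h))·∫_K e^{−(V+g)}` and `LocCondStability` BY NAME with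
# `b = (B + n·q_max)∕(2σ − h)` — FIVE numbers, NO radius (row NE7b, node U5c; residual (R2′) family (2); the refuter's ω-ne7bref-g73-1)

Cell `pub-balaban`, sub-cell `t4`, spine estimate NE7b (`T4WeightBudget.RelWeightBound`; the cell's OWN estimate — NOT PRINTED in
[Bałaban 1983–89], NOT PROVED).  Crux-route work under `Spine/NE7b/` by the row's OWNER; NOTHING of Bałaban's is named or asserted;
no `T4Continuum/Support` leaf typed; no `def`; zero `sorry`.

WHY.  `…ConvexWindowTiltCentred` §4–§5 socket the windowed road's END from primitive constants with the centring letter paid BY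
SUPPORT: budget `B·((2σ − c₃ρ)⁻¹ + ρ²)`.  That is TRUE but a MODEL-window device — at print's window radius the `B·ρ²` summand is
`10^{163…191}` nats per cube against `10^{113}` (refuter E-ne7bref-g71-3 ∕ F449 ∕ F454 ∕ F455).  What print can afford is the
fibre DIMENSION: `…ConvexWindowTiltCentred` §3 pays the centring letter by the windowed VIRIAL inequality (`Σ_k q_k m_k² ≤ q_max·n∕λ`
for orthonormal directions, Bessel) under the variational letter `0 ≤ ⟪∇V 0, y⟫` on `K`.  For `V = ⟪x,Ax⟫ + P` that letter reads
`0 ≤ DP(0)[y]` (the quadratic form is critical at `0`), and it is discharged outright by `DP(0) = 0` — «print expands at the critical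
configuration», one line of the (A1c) instance's anharmonicity (refuter κ-ne7bref-g72-1 (i)).  This file is the refuter's located ask
ω-ne7bref-g73-1 AS THEOREMS: the §3-virial twin of §4–§5 with the modulus `2σ − h` ON `K` from
`…ConvexWindowSuppliers.firstOrderOn_quadratic_add_of_hessianOn` (`h` = the Hessian-smallness of `P` ON the window; `= c₃ρ` when it
comes from a third-derivative bound, `…ConvexWindowSuppliers` §3), and the junction BY NAME.  By value (refuter F455): `≤ 2n·q_max∕λ`
nats at `λ = O(1)`, room ≥ 58 orders under print's (1.8) count.

WHAT IS PROVED ([folklore]):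
* §1 `inner_gradient_quadratic_add_zero`: `⟪∇V 0, y⟫ = DP(0)[y]` for `V = ⟪·, A·⟫ + P`, `A` symmetric.
* §1 **`exp_moment_le_of_quadratic_add_hessianSmall_on_convexWindow_orthonormal`**: `K` convex bounded measurable with `0 ∈ K`; `A`
  symmetric `σ`-coercive; `P ∈ C²`, `D²P(x)[v,v] ≥ −h‖v‖²` for `x ∈ K`, `DP(0) = 0`; `h < 2σ`; `u` orthonormal, `0 ≤ q_k ≤ q_max`:
  `∫_K e^{−V} ≤ exp((Σ_k q_k + n·q_max)∕(2σ − h)) · ∫_K e^{−(V + Σ_k q_k⟪u_k,·⟫²)}`.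
* §1 `hessianSmallWindowCarrier_le`: `Σ_k q_k ≤ B` ⟹ carrier `≤ exp((B + n·q_max)∕(2σ − h))`.
* §2 **`locCondStability_of_hessianSmallWindowCarrier_on_support`**: per `(j, g, y)` the window, operator, remainder, weights,
  orthonormal directions; the numbers `σ, h, q_max, B` y-UNIFORM per `(j, g)` and the fibre dimension `n j g` ⟹
  `LocCondStability T S K μ ρ₀ M b`, `b j g = (B j g + n j g·q_max j g)∕(2σ j g − h j g)`, integrability conjunct included — THE
  family-(2) socket for the (A3) instance when print's expansion point is critical; otherwise `…ConvexWindowTiltRecentred` (K-argmin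
  re-centring, `G₀ = ‖∇V 0‖` displayed; refuter κ-ne7bref-g72-1 (ii), σ-ne7bref-g74-1).

NOT HERE (honest): which window ∕ operator ∕ remainder ∕ weights Bałaban's steps produce, and the five numbers BY VALUE ((A1c)∕(A3)
readings; `λ = 2σ − h` by value = the refuter's BILL item 1, closed by value in the RT chart only — F463); the corridor letter of the
R-step statement (refuter κ-ne7bref-g73-1); anything of Bałaban's.  NE7b NOT PRINTED ∕ NOT PROVED; spine PROVED 0∕9; rung (B)+1 on a
FINITE torus — NOT infinite volume, NOT the mass gap, NOT Clay.
HONEST DEPENDENCY: continuum YM on T⁴ ⇐ BetaPertH ∧ nine spine estimates (0/9 proved); BetaPertH ⇐ (D1) ∧ (D4) ∧ CAP+tail.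
-/

set_option autoImplicit false

noncomputable section

open MeasureTheory Real Finset
open scoped RealInnerProductSpace
open Summit.QuantumFields.BalabanUV.T4Continuum.B16HistoryIndexedRepr Summit.QuantumFields.BalabanUV.T4Continuum.B16HistoryReprChain
open Summit.QuantumFields.BalabanUV.T4Continuum.NE7b.PrefixExtraction Summit.QuantumFields.BalabanUV.T4Continuum.NE7b.LocalConditionalStability
open Summit.QuantumFields.BalabanUV.T4Continuum.NE7b.CarrierOnSupport
open Summit.QuantumFields.BalabanUV.T4Continuum.NE7b.ConvexTiltSuppliers
open Summit.QuantumFields.BalabanUV.T4Continuum.NE7b.ConvexWindowVirial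
open Summit.QuantumFields.BalabanUV.T4Continuum.NE7b.ConvexWindowSuppliers
open Summit.QuantumFields.BalabanUV.T4Continuum.NE7b.ConvexWindowTiltCentred

namespace Summit.QuantumFields.BalabanUV.T4Continuum.NE7b.ConvexWindowVirialSocket

variable {n : ℕ}

/-! ## §1 The END: Hessian-small remainder, critical centre, NO radius -/

section VirialTwin

/-- For `V = ⟪·, A·⟫ + P` with `A` symmetric and `P` differentiable at `0`: `⟪∇V 0, y⟫ = DP(0)[y]` (the quadratic form is critical
at the origin). [folklore] -/
theorem inner_gradient_quadratic_add_zero (A : EuclideanSpace ℝ (Fin n) →L[ℝ] EuclideanSpace ℝ (Fin n))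
    (hA : ∀ v w : EuclideanSpace ℝ (Fin n), ⟪A v, w⟫ = ⟪v, A w⟫) {P : EuclideanSpace ℝ (Fin n) → ℝ}
    (hP : DifferentiableAt ℝ P 0) (y : EuclideanSpace ℝ (Fin n)) :
    ⟪gradient (fun z : EuclideanSpace ℝ (Fin n) => ⟪z, A z⟫ + P z) 0, y⟫ = fderiv ℝ P 0 y := by
  have hq : HasFDerivAt (fun z : EuclideanSpace ℝ (Fin n) => ⟪z, A z⟫)
      (InnerProductSpace.toDual ℝ (EuclideanSpace ℝ (Fin n)) ((2 : ℝ) • A 0)) 0 :=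
    hasGradientAt_iff_hasFDerivAt.1 (hasGradientAt_quadratic A hA 0)
  rw [inner_gradient_eq_fderiv, fderiv_fun_add hq.differentiableAt hP, hq.fderiv]
  simp

/-- **THE WINDOWED CONVEXITY ROAD FROM PRIMITIVE CONSTANTS, VIRIAL TWIN** (refuter ω-ne7bref-g73-1).  `K` convex, bounded,
measurable with `0 ∈ K`; `A` symmetric with `⟪v, Av⟫ ≥ σ‖v‖²`; `P ∈ C²` with `D²P(x)[v, v] ≥ −h‖v‖²` for `x ∈ K` (Hessian-small ON the
window) and `DP(0) = 0` (the expansion point is critical); `h < 2σ`; `u` ORTHONORMAL, `0 ≤ q_k ≤ q_max`.  Then, for `V = ⟪·, A·⟫ + P`,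
`∫_K e^{−V} ≤ exp((Σ_k q_k + n·q_max)∕(2σ − h)) · ∫_K e^{−(V + Σ_k q_k⟪u_k,·⟫²)}` — §3 with the modulus `2σ − h` ON `K` from
`…ConvexWindowSuppliers.firstOrderOn_quadratic_add_of_hessianOn`; FIVE numbers `σ, h, n, q_max, Σ q`, NO radius. [folklore] -/
theorem exp_moment_le_of_quadratic_add_hessianSmall_on_convexWindow_orthonormal {P : EuclideanSpace ℝ (Fin n) → ℝ}
    {σ h qm : ℝ} {r : ℕ} {K : Set (EuclideanSpace ℝ (Fin n))} (A : EuclideanSpace ℝ (Fin n) →L[ℝ] EuclideanSpace ℝ (Fin n))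
    (hK : Convex ℝ K) (hKm : MeasurableSet K) (hKb : Bornology.IsBounded K) (h0 : (0 : EuclideanSpace ℝ (Fin n)) ∈ K)
    (hA : ∀ v w : EuclideanSpace ℝ (Fin n), ⟪A v, w⟫ = ⟪v, A w⟫) (hσ : ∀ v : EuclideanSpace ℝ (Fin n), σ * ‖v‖ ^ 2 ≤ ⟪v, A v⟫)
    (hP : ContDiff ℝ 2 P) (hP1 : fderiv ℝ P 0 = 0)
    (hH : ∀ x ∈ K, ∀ v : EuclideanSpace ℝ (Fin n), -h * ‖v‖ ^ 2 ≤ iteratedFDeriv ℝ 2 P x ![v, v]) (hgap : h < 2 * σ)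
    (q : Fin r → ℝ) (hq : ∀ k, 0 ≤ q k) (hqm0 : 0 ≤ qm) (hqm : ∀ k, q k ≤ qm)
    (u : Fin r → EuclideanSpace ℝ (Fin n)) (hu : Orthonormal ℝ u) :
    ∫ x in K, exp (-(⟪x, A x⟫ + P x)) ≤
      exp ((∑ k, q k + n * qm) / (2 * σ - h)) * ∫ x in K, exp (-((⟪x, A x⟫ + P x) + ∑ k, q k * ⟪u k, x⟫ ^ 2)) := by
  have hV1 : ContDiff ℝ 1 fun x : EuclideanSpace ℝ (Fin n) => ⟪x, A x⟫ + P x :=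
    (contDiff_id.inner ℝ A.contDiff).add (hP.of_le (by norm_num))
  have hcrit : ∀ y ∈ K, 0 ≤ ⟪gradient (fun z : EuclideanSpace ℝ (Fin n) => ⟪z, A z⟫ + P z) 0, y⟫ := fun y _ => by
    rw [inner_gradient_quadratic_add_zero A hA (hP.differentiable (by norm_num) 0) y, hP1]
    simp
  exact exp_moment_le_of_uniformlyConvex_on_boundedConvexWindow_orthonormal (V := fun x => ⟪x, A x⟫ + P x) (sub_pos.2 hgap) hK
    hKm hKb h0 hV1 (firstOrderOn_quadratic_add_of_hessianOn A hK hA hσ hP hH) hcrit q hq hqm0 hqm u hu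

/-- The virial-twin carrier `∫_K e^{−V} ∕ ∫_K e^{−(V+g)}`, `V = ⟪x,Ax⟫ + P`, is at most `exp((B + n·q_max)∕(2σ − h))` once `Σ_k q_k ≤ B`
(trace letter; `u` orthonormal). [folklore] -/
theorem hessianSmallWindowCarrier_le {P : EuclideanSpace ℝ (Fin n) → ℝ} {σ h qm B : ℝ} {r : ℕ}
    {K : Set (EuclideanSpace ℝ (Fin n))} (A : EuclideanSpace ℝ (Fin n) →L[ℝ] EuclideanSpace ℝ (Fin n))
    (hK : Convex ℝ K) (hKm : MeasurableSet K) (hKb : Bornology.IsBounded K) (h0 : (0 : EuclideanSpace ℝ (Fin n)) ∈ K)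
    (hA : ∀ v w : EuclideanSpace ℝ (Fin n), ⟪A v, w⟫ = ⟪v, A w⟫) (hσ : ∀ v : EuclideanSpace ℝ (Fin n), σ * ‖v‖ ^ 2 ≤ ⟪v, A v⟫)
    (hP : ContDiff ℝ 2 P) (hP1 : fderiv ℝ P 0 = 0)
    (hH : ∀ x ∈ K, ∀ v : EuclideanSpace ℝ (Fin n), -h * ‖v‖ ^ 2 ≤ iteratedFDeriv ℝ 2 P x ![v, v]) (hgap : h < 2 * σ)
    (q : Fin r → ℝ) (hq : ∀ k, 0 ≤ q k) (hqm0 : 0 ≤ qm) (hqm : ∀ k, q k ≤ qm)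
    (u : Fin r → EuclideanSpace ℝ (Fin n)) (hu : Orthonormal ℝ u) (hB : ∑ k, q k ≤ B) :
    (∫ x in K, exp (-(⟪x, A x⟫ + P x))) / (∫ x in K, exp (-((⟪x, A x⟫ + P x) + ∑ k, q k * ⟪u k, x⟫ ^ 2))) ≤
      exp ((B + n * qm) / (2 * σ - h)) := by
  refine div_le_of_le_mul₀ (integral_nonneg fun _ => (exp_pos _).le) (exp_pos _).le ?_
  refine (exp_moment_le_of_quadratic_add_hessianSmall_on_convexWindow_orthonormal A hK hKm hKb h0 hA hσ hP hP1 hH hgap q hq hqm0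
    hqm u hu).trans (mul_le_mul_of_nonneg_right (exp_le_exp.2 ?_) (integral_nonneg fun _ => (exp_pos _).le))
  exact div_le_div_of_nonneg_right (by linarith) (sub_pos.2 hgap).le

end VirialTwin

/-! ## §2 The junction: `LocCondStability` BY NAME — the family-(2) socket for the (A3) instance -/

section JunctionVirial

variable {Pt : Type} [DecidableEq Pt] {C : ℕ → Type} {𝒢 : (j : ℕ) → GoodClass (C j)}

/-- **LCS FOR THE HESSIAN-SMALL WINDOWED CARRIER, VIRIAL TWIN, ON THE SUPPORT — the family-(2) socket for the (A3) instance**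
(refuter ω-ne7bref-g73-1).  At every pattern prefix `g` of a level `j < K` and background `y` let
`M j g y = ∫_{Kw} e^{−V} ∕ ∫_{Kw} e^{−(V+g)}`, `V = ⟪x, A x⟫ + P`, for the data at `(j, g, y)` on `EuclideanSpace ℝ (Fin (n j g))` —
window `Kw j g y`, operator `A j g y`, remainder `P j g y`, weights `q`, ORTHONORMAL directions `u` —; suppose `M j g` is a.e.-strongly
measurable and ON THE SUPPORT OF THE TERM: `Kw` convex bounded measurable with `0 ∈ Kw`, `A` symmetric `σ j g`-coercive, `P ∈ C²` with
`D²P ≥ −(h j g)` ON `Kw` and `DP(0) = 0`, `h < 2σ`, `0 ≤ q_k ≤ qmax j g`, `Σ_k q_k ≤ B j g` — the numbers `σ, h, qmax, B` y-UNIFORM, the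
fibre dimension `n j g`, NO radius.  Then `LocCondStability T S K μ ρ₀ M b` with `b j g = (B j g + n j g·qmax j g)∕(2σ j g − h j g)`,
integrability conjunct included. [folklore] -/
theorem locCondStability_of_hessianSmallWindowCarrier_on_support (T : Tower Pt C 𝒢)
    (Spat : (j : ℕ) → (Fin j → Pt) → Finset Pt) (K : ℕ) [∀ j, MeasurableSpace (C j)] (μ : (j : ℕ) → Measure (C j))
    (ρ₀ : C 0 → ℝ) (M : (j : ℕ) → (Fin j → Pt) → C j → ℝ) (n r : (j : ℕ) → (Fin j → Pt) → ℕ)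
    (Kw : (j : ℕ) → (g : Fin j → Pt) → C j → Set (EuclideanSpace ℝ (Fin (n j g))))
    (A : (j : ℕ) → (g : Fin j → Pt) → C j → (EuclideanSpace ℝ (Fin (n j g)) →L[ℝ] EuclideanSpace ℝ (Fin (n j g))))
    (P : (j : ℕ) → (g : Fin j → Pt) → C j → EuclideanSpace ℝ (Fin (n j g)) → ℝ)
    (q : (j : ℕ) → (g : Fin j → Pt) → C j → Fin (r j g) → ℝ)
    (u : (j : ℕ) → (g : Fin j → Pt) → C j → Fin (r j g) → EuclideanSpace ℝ (Fin (n j g)))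
    (σ h qmax B : (j : ℕ) → (Fin j → Pt) → ℝ) (hρ : (𝒢 0).Gd ρ₀) (h0 : ∀ x, 0 ≤ ρ₀ x)
    (hM : ∀ j g, j < K → g ∈ admS T Spat j → ∀ y, M j g y =
      (∫ x in Kw j g y, exp (-(⟪x, A j g y x⟫ + P j g y x))) /
        ∫ x in Kw j g y, exp (-((⟪x, A j g y x⟫ + P j g y x) + ∑ k, q j g y k * ⟪u j g y k, x⟫ ^ 2)))
    (hMm : ∀ j g, j < K → g ∈ admS T Spat j → AEStronglyMeasurable (M j g) (μ j))
    (hKc : ∀ j g, j < K → g ∈ admS T Spat j → ∀ y, T.eterm ρ₀ j g y ≠ 0 → Convex ℝ (Kw j g y))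
    (hKm : ∀ j g, j < K → g ∈ admS T Spat j → ∀ y, T.eterm ρ₀ j g y ≠ 0 → MeasurableSet (Kw j g y))
    (hKb : ∀ j g, j < K → g ∈ admS T Spat j → ∀ y, T.eterm ρ₀ j g y ≠ 0 → Bornology.IsBounded (Kw j g y))
    (hK0 : ∀ j g, j < K → g ∈ admS T Spat j → ∀ y, T.eterm ρ₀ j g y ≠ 0 → (0 : EuclideanSpace ℝ (Fin (n j g))) ∈ Kw j g y)
    (hA : ∀ j g, j < K → g ∈ admS T Spat j → ∀ y, T.eterm ρ₀ j g y ≠ 0 →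
      ∀ v w : EuclideanSpace ℝ (Fin (n j g)), ⟪A j g y v, w⟫ = ⟪v, A j g y w⟫)
    (hσ : ∀ j g, j < K → g ∈ admS T Spat j → ∀ y, T.eterm ρ₀ j g y ≠ 0 →
      ∀ v : EuclideanSpace ℝ (Fin (n j g)), σ j g * ‖v‖ ^ 2 ≤ ⟪v, A j g y v⟫)
    (hP : ∀ j g, j < K → g ∈ admS T Spat j → ∀ y, T.eterm ρ₀ j g y ≠ 0 → ContDiff ℝ 2 (P j g y))
    (hP1 : ∀ j g, j < K → g ∈ admS T Spat j → ∀ y, T.eterm ρ₀ j g y ≠ 0 → fderiv ℝ (P j g y) 0 = 0)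
    (hH : ∀ j g, j < K → g ∈ admS T Spat j → ∀ y, T.eterm ρ₀ j g y ≠ 0 →
      ∀ x ∈ Kw j g y, ∀ v : EuclideanSpace ℝ (Fin (n j g)), -h j g * ‖v‖ ^ 2 ≤ iteratedFDeriv ℝ 2 (P j g y) x ![v, v])
    (hgap : ∀ j g, j < K → g ∈ admS T Spat j → h j g < 2 * σ j g)
    (hq : ∀ j g, j < K → g ∈ admS T Spat j → ∀ y k, 0 ≤ q j g y k)
    (hqm0 : ∀ j g, j < K → g ∈ admS T Spat j → 0 ≤ qmax j g)
    (hqm : ∀ j g, j < K → g ∈ admS T Spat j → ∀ y, T.eterm ρ₀ j g y ≠ 0 → ∀ k, q j g y k ≤ qmax j g)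
    (hu : ∀ j g, j < K → g ∈ admS T Spat j → ∀ y, T.eterm ρ₀ j g y ≠ 0 → Orthonormal ℝ (u j g y))
    (hB : ∀ j g, j < K → g ∈ admS T Spat j → ∀ y, T.eterm ρ₀ j g y ≠ 0 → ∑ k, q j g y k ≤ B j g)
    (hint : ∀ j g, j < K → g ∈ admS T Spat j → Integrable (T.eterm ρ₀ j g) (μ j)) :
    LocCondStability T Spat K μ ρ₀ M (fun j g => (B j g + n j g * qmax j g) / (2 * σ j g - h j g)) := by
  refine locCondStability_of_carrier_le_on_support T Spat K μ ρ₀ M _ hρ h0 hMm (fun j g hj hg y => ?_)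
    (fun j g hj hg y hy => ?_) hint
  · rw [hM j g hj hg y]
    exact div_nonneg (integral_nonneg fun _ => (exp_pos _).le) (integral_nonneg fun _ => (exp_pos _).le)
  · rw [hM j g hj hg y]
    exact hessianSmallWindowCarrier_le (A j g y) (hKc j g hj hg y hy) (hKm j g hj hg y hy) (hKb j g hj hg y hy) (hK0 j g hj hg y hy)
      (hA j g hj hg y hy) (hσ j g hj hg y hy) (hP j g hj hg y hy) (hP1 j g hj hg y hy) (hH j g hj hg y hy) (hgap j g hj hg)
      _ (hq j g hj hg y) (hqm0 j g hj hg) (hqm j g hj hg y hy) _ (hu j g hj hg y hy) (hB j g hj hg y hy)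

end JunctionVirial

end Summit.QuantumFields.BalabanUV.T4Continuum.NE7b.ConvexWindowVirialSocket

end
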